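import Literature.NumberTheory.EllipticCurves.ModularCurveIharaLemma
import Literature.NumberTheory.EllipticCurves.NewformsStrongMultiplicityOne
import HarnessLib

/-!
# Two-prime old-space exactness ON CYCLES — the sub-partition: FULL exactness is automatic when one prime is idle (cell `b2b-bsdres`, seat additive-p4 gen 33, line V56)

HONEST FRAMING (verbatim, cell `b2b-bsdres`): the goal of the cell is to DELETE the COMBINATION-SHAPED
residual classes for ALL analytic-rank `≤ 1` curves over `ℚ` — "full BSD formula for every rank `≤ 1`
curve in class `C`" assembled STRICTLY from published theorems — so that the rank-`≤ 1` remainder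
becomes exactly the CONSTRUCTION-SHAPED classes, which are TYPED (missing-input Props), NOT attempted;
this is not "finishing BSD". This file: TOOL theorems (pure algebra of additive functionals on
`H₁(X₀(·), ℤ) = periodHomology ·` and the composition of degeneracy pull-backs), 0 defs, 0 facts,
nothing booked; X4 CONSTRUCTION-SHAPED; no mark moves.

## Why

`X4/TwoPrimeExactnessBridgesOnCycles.lean` (K101) reduces the signed cycle-level exactness `hexactC` of
the additive certificate (K95/K97) to FULL cycle-level exactness of the Calegari–Venkatesh level-raising
complex (the `i = 2` case of their Conjecture 4.1 at a non-Eisenstein `𝔪`) plus Ihara by name. This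
file is the cycle-level twin of `X4/TwoPrimeExactnessBridges.fullExact_of_oldAtFirst` (K98b): when the
maximal ideal is NOT level-raising at `ℓ₁`, the intermediate level `M₀ℓ₁` carries no `ℓ₁`-new forms
there, every functional of `𝓛₂` is `ℓ₁`-old from `𝓛₀`, and FULL cycle-exactness follows from the
two-copy injectivity at `ℓ₁` (Ihara) ALONE — the only extra ingredient on cycles being the commutation
of the two factorizations `M₀ → M₀ℓ₁ → N` and `M₀ → M₀ℓ₂ → N` of the degeneracy maps
(`degeneracyMap0_comp`, transposed: `dualMap_dualMap_degeneracyMap0`). Consequence: the typed target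
T-V54 has content ONLY at maximal ideals level-raising at BOTH primes (instrument E12b's locus).

## References

* F. Calegari, A. Venkatesh, Astérisque 409 (2019), §(10.2), Ch. 4 Thm 35, Conj. 4.1. [cite: CalegariVenkatesh2019, Ch. 4, Conj. 4.1]
* K. Ribet, Proc. ICM 1983 (1984), Thm. 4.1. [cite: Ribet1984ICM, Thm. 4.1]
* F. Diamond, J. Shurman, *A First Course in Modular Forms* (2005), §5.6 (degeneracy maps compose). [cite: DiamondShurman2005, §5.6 Exercise 5.6.2]
-/

noncomputable section

open scoped MatrixGroups ModularForm

open CongruenceSubgroup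

open Literature.NumberTheory.EllipticCurves Literature.NumberTheory.EllipticCurves.ModularForms

namespace Summit.BirchSwinnertonDyer.Rank1Residual.LevelLowering

section SubpartitionCycles

variable {k : Type*} [CommRing k]

/-- Composition of degeneracy pull-backs on functionals: `d(M₀→M₂; d₁)^∨ ∘ d(M₂→N; d₂)^∨ = d(M₀→N; d₁d₂)^∨`
(`degeneracyMap0_comp`, by transposition). [cite: DiamondShurman2005, §5.6 Exercise 5.6.2] -/
theorem dualMap_dualMap_degeneracyMap0 {M₀ M₂ N d₁ d₂ : ℕ} [NeZero M₀] [NeZero M₂] [NeZero N]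
    [NeZero d₁] [NeZero d₂] (h₁ : M₀ * d₁ ∣ M₂) (h₂ : M₂ * d₂ ∣ N)
    (y : Module.Dual ℂ (CuspForm (Gamma0 N) 2)) :
    (degeneracyMap0 M₀ M₂ d₁ 2).dualMap ((degeneracyMap0 M₂ N d₂ 2).dualMap y) =
      (degeneracyMap0 M₀ N (d₁ * d₂) 2).dualMap y := by
  rw [← degeneracyMap0_comp M₀ M₂ N d₁ d₂ 2 h₁ h₂]
  rfl

/-- Degeneracy pull-backs with equal parameters agree (the `NeZero` instance is a proposition). [folklore] -/
theorem dualMap_degeneracyMap0_congr {M N d d' : ℕ} [NeZero M] [NeZero N] [NeZero d] [NeZero d']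
    (h : d = d') (y : Module.Dual ℂ (CuspForm (Gamma0 N) 2)) :
    (degeneracyMap0 M N d 2).dualMap y = (degeneracyMap0 M N d' 2).dualMap y := by
  subst h
  rfl

/-- **CASE B ON CYCLES (first prime idle): FULL CYCLE-EXACTNESS FROM ONE-PRIME DATA.** Levels
`M₀ ∣ M₁, M₂ ∣ N` with `M₀ℓ₂ ∣ M₁`, `M₀ℓ₁ ∣ M₂`, `M₁ℓ₁ ∣ N`, `M₂ℓ₂ ∣ N` AND the two factorizations of
`M₀ → N` agreeing (`M₁·1 ∣ N`, `M₂·1 ∣ N`, used through `degeneracyMap0_comp`). If every `Λ ∈ 𝓛₂` (level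
`M₂ = M₀ℓ₁`) is `ℓ₁`-OLD from `𝓛₀` on cycles (no `ℓ₁`-new forms at the maximal ideal at level `M₀ℓ₁` —
automatic when it is not level-raising at `ℓ₁`), `𝓛₁` is closed under adding `ℓ₂`-old pull-backs from
`𝓛₀`, `𝓛₀` under negation, and the two `ℓ₁`-degeneracy copies of `𝓛₁` are jointly injective on
`H₁(X₀(N))` (Ihara at `ℓ₁`, dual form, top level), then the FULL complex is exact on cycles — the
hypothesis `hfullC` of `signedExactCycles_of_fullExactCycles`. So on cycles, too, T-V54 has content only
at maximal ideals level-raising at BOTH primes. [cite: Ribet1984ICM, Thm. 4.1] [cite: CalegariVenkatesh2019, Ch. 4, Conj. 4.1] -/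
theorem fullExactCycles_of_oldAtFirst {M₀ M₁ M₂ N ℓ₁ ℓ₂ : ℕ}
    [NeZero M₀] [NeZero M₁] [NeZero M₂] [NeZero N] [NeZero ℓ₁] [NeZero ℓ₂]
    (h01 : M₀ * 1 ∣ M₁) (h01' : M₀ * ℓ₂ ∣ M₁) (h02 : M₀ * 1 ∣ M₂) (h02' : M₀ * ℓ₁ ∣ M₂)
    (h1N : M₁ * 1 ∣ N) (h1N' : M₁ * ℓ₁ ∣ N) (h2N : M₂ * 1 ∣ N) (h2N' : M₂ * ℓ₂ ∣ N)
    (𝓛₁ : Set (Module.Dual ℂ (CuspForm (Gamma0 M₁) 2) → k))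
    (𝓛₂ : Set (Module.Dual ℂ (CuspForm (Gamma0 M₂) 2) → k))
    (𝓛₀ : Set (Module.Dual ℂ (CuspForm (Gamma0 M₀) 2) → k))
    (hold₂ : ∀ Λ ∈ 𝓛₂, ∃ Z ∈ 𝓛₀, ∃ Z' ∈ 𝓛₀, ∀ x ∈ periodHomology M₂,
      Λ x = Z ((degeneracyMap0 M₀ M₂ 1 2).dualMap x) + Z' ((degeneracyMap0 M₀ M₂ ℓ₁ 2).dualMap x))
    (hadd₁ : ∀ Λ ∈ 𝓛₁, ∀ Z ∈ 𝓛₀, ∀ Z' ∈ 𝓛₀, (fun x ↦ Λ x +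
      (Z ((degeneracyMap0 M₀ M₁ 1 2).dualMap x) + Z' ((degeneracyMap0 M₀ M₁ ℓ₂ 2).dualMap x))) ∈ 𝓛₁)
    (hneg₀ : ∀ Z ∈ 𝓛₀, (fun x ↦ -Z x) ∈ 𝓛₀)
    (hinj : ∀ G ∈ 𝓛₁, ∀ G' ∈ 𝓛₁,
      (∀ y ∈ periodHomology N,
        G ((degeneracyMap0 M₁ N 1 2).dualMap y) + G' ((degeneracyMap0 M₁ N ℓ₁ 2).dualMap y) = 0) →
      (∀ x ∈ periodHomology M₁, G x = 0) ∧ (∀ x ∈ periodHomology M₁, G' x = 0)) :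
    ∀ Λ₁ ∈ 𝓛₁, ∀ Λ₁' ∈ 𝓛₁, ∀ Λ₂ ∈ 𝓛₂, ∀ Λ₂' ∈ 𝓛₂,
      (∀ y ∈ periodHomology N,
        Λ₁ ((degeneracyMap0 M₁ N 1 2).dualMap y) + Λ₁' ((degeneracyMap0 M₁ N ℓ₁ 2).dualMap y) +
        (Λ₂ ((degeneracyMap0 M₂ N 1 2).dualMap y) + Λ₂' ((degeneracyMap0 M₂ N ℓ₂ 2).dualMap y)) = 0) →
      ∃ Z₁ ∈ 𝓛₀, ∃ Z₂ ∈ 𝓛₀, ∃ Z₃ ∈ 𝓛₀, ∃ Z₄ ∈ 𝓛₀,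
        (∀ x ∈ periodHomology M₁, Λ₁ x =
          Z₁ ((degeneracyMap0 M₀ M₁ 1 2).dualMap x) + Z₂ ((degeneracyMap0 M₀ M₁ ℓ₂ 2).dualMap x)) ∧
        (∀ x ∈ periodHomology M₁, Λ₁' x =
          Z₃ ((degeneracyMap0 M₀ M₁ 1 2).dualMap x) + Z₄ ((degeneracyMap0 M₀ M₁ ℓ₂ 2).dualMap x)) ∧
        (∀ x ∈ periodHomology M₂, Λ₂ x =
          -(Z₁ ((degeneracyMap0 M₀ M₂ 1 2).dualMap x) + Z₃ ((degeneracyMap0 M₀ M₂ ℓ₁ 2).dualMap x))) ∧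
        (∀ x ∈ periodHomology M₂, Λ₂' x =
          -(Z₂ ((degeneracyMap0 M₀ M₂ 1 2).dualMap x) + Z₄ ((degeneracyMap0 M₀ M₂ ℓ₁ 2).dualMap x))) := by
  intro Λ₁ hΛ₁ Λ₁' hΛ₁' Λ₂ hΛ₂ Λ₂' hΛ₂' hrel
  obtain ⟨Z₁, hZ₁, Z₃, hZ₃, e2⟩ := hold₂ Λ₂ hΛ₂
  obtain ⟨Z₂, hZ₂, Z₄, hZ₄, e2'⟩ := hold₂ Λ₂' hΛ₂'
  -- cycles pulled back to the intermediate levels are cycles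
  have hm2 : ∀ y ∈ periodHomology N, (degeneracyMap0 M₂ N 1 2).dualMap y ∈ periodHomology M₂ :=
    fun y hy ↦ dualMap_degeneracyMap0_mem_periodHomology M₂ N 1 h2N hy
  have hm2' : ∀ y ∈ periodHomology N, (degeneracyMap0 M₂ N ℓ₂ 2).dualMap y ∈ periodHomology M₂ :=
    fun y hy ↦ dualMap_degeneracyMap0_mem_periodHomology M₂ N ℓ₂ h2N' hy
  -- the four factorizations `M₀ → M₂ → N` = `M₀ → M₁ → N`
  have c11 : ∀ y, (degeneracyMap0 M₀ M₂ 1 2).dualMap ((degeneracyMap0 M₂ N 1 2).dualMap y) =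
      (degeneracyMap0 M₀ M₁ 1 2).dualMap ((degeneracyMap0 M₁ N 1 2).dualMap y) := fun y ↦ by
    rw [dualMap_dualMap_degeneracyMap0 h02 h2N, dualMap_dualMap_degeneracyMap0 h01 h1N]
  have c21 : ∀ y, (degeneracyMap0 M₀ M₂ ℓ₁ 2).dualMap ((degeneracyMap0 M₂ N 1 2).dualMap y) =
      (degeneracyMap0 M₀ M₁ 1 2).dualMap ((degeneracyMap0 M₁ N ℓ₁ 2).dualMap y) := fun y ↦ by
    rw [dualMap_dualMap_degeneracyMap0 h02' h2N, dualMap_dualMap_degeneracyMap0 h01 h1N']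
    exact dualMap_degeneracyMap0_congr (by rw [mul_one, one_mul]) y
  have c12 : ∀ y, (degeneracyMap0 M₀ M₂ 1 2).dualMap ((degeneracyMap0 M₂ N ℓ₂ 2).dualMap y) =
      (degeneracyMap0 M₀ M₁ ℓ₂ 2).dualMap ((degeneracyMap0 M₁ N 1 2).dualMap y) := fun y ↦ by
    rw [dualMap_dualMap_degeneracyMap0 h02 h2N', dualMap_dualMap_degeneracyMap0 h01' h1N]
    exact dualMap_degeneracyMap0_congr (by rw [mul_one, one_mul]) y
  have c22 : ∀ y, (degeneracyMap0 M₀ M₂ ℓ₁ 2).dualMap ((degeneracyMap0 M₂ N ℓ₂ 2).dualMap y) =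
      (degeneracyMap0 M₀ M₁ ℓ₂ 2).dualMap ((degeneracyMap0 M₁ N ℓ₁ 2).dualMap y) := fun y ↦ by
    rw [dualMap_dualMap_degeneracyMap0 h02' h2N', dualMap_dualMap_degeneracyMap0 h01' h1N']
    exact dualMap_degeneracyMap0_congr (Nat.mul_comm _ _) y
  -- `G := Λ₁ + Z₁∘d₁ + Z₂∘d_{ℓ₂}`, `G' := Λ₁' + Z₃∘d₁ + Z₄∘d_{ℓ₂}` satisfy `G∘d¹₁ + G'∘d¹_{ℓ₁} = 0`
  obtain ⟨hG, hG'⟩ := hinj _ (hadd₁ Λ₁ hΛ₁ Z₁ hZ₁ Z₂ hZ₂) _ (hadd₁ Λ₁' hΛ₁' Z₃ hZ₃ Z₄ hZ₄)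
    (fun y hy ↦ by
      have h0 := hrel y hy
      have h1 := e2 _ (hm2 y hy)
      have h2 := e2' _ (hm2' y hy)
      rw [c11, c21] at h1
      rw [c12, c22] at h2
      rw [h1, h2] at h0
      linear_combination h0)
  refine ⟨_, hneg₀ Z₁ hZ₁, _, hneg₀ Z₂ hZ₂, _, hneg₀ Z₃ hZ₃, _, hneg₀ Z₄ hZ₄,
    fun x hx ↦ ?_, fun x hx ↦ ?_, fun x hx ↦ ?_, fun x hx ↦ ?_⟩
  · have := hG x hx; linear_combination this
  · have := hG' x hx; linear_combination this
  · have := e2 x hx; linear_combination this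
  · have := e2' x hx; linear_combination this


/-- **CASE B ON CYCLES (second prime idle), the mirror statement.** If every `Λ ∈ 𝓛₁` (level `M₁ = M₀ℓ₂`)
is `ℓ₂`-OLD from `𝓛₀` on cycles, `𝓛₂` is closed under adding `ℓ₁`-old pull-backs from `𝓛₀`, and the two
`ℓ₂`-degeneracy copies of `𝓛₂` are jointly injective on `H₁(X₀(N))` (Ihara at `ℓ₂`, dual form, top
level), then the FULL complex is exact on cycles (`hfullC`). [cite: Ribet1984ICM, Thm. 4.1] [cite: CalegariVenkatesh2019, Ch. 4, Conj. 4.1] -/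
theorem fullExactCycles_of_oldAtSecond {M₀ M₁ M₂ N ℓ₁ ℓ₂ : ℕ}
    [NeZero M₀] [NeZero M₁] [NeZero M₂] [NeZero N] [NeZero ℓ₁] [NeZero ℓ₂]
    (h01 : M₀ * 1 ∣ M₁) (h01' : M₀ * ℓ₂ ∣ M₁) (h02 : M₀ * 1 ∣ M₂) (h02' : M₀ * ℓ₁ ∣ M₂)
    (h1N : M₁ * 1 ∣ N) (h1N' : M₁ * ℓ₁ ∣ N) (h2N : M₂ * 1 ∣ N) (h2N' : M₂ * ℓ₂ ∣ N)
    (𝓛₁ : Set (Module.Dual ℂ (CuspForm (Gamma0 M₁) 2) → k))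
    (𝓛₂ : Set (Module.Dual ℂ (CuspForm (Gamma0 M₂) 2) → k))
    (𝓛₀ : Set (Module.Dual ℂ (CuspForm (Gamma0 M₀) 2) → k))
    (hold₁ : ∀ Λ ∈ 𝓛₁, ∃ Z ∈ 𝓛₀, ∃ Z' ∈ 𝓛₀, ∀ x ∈ periodHomology M₁,
      Λ x = Z ((degeneracyMap0 M₀ M₁ 1 2).dualMap x) + Z' ((degeneracyMap0 M₀ M₁ ℓ₂ 2).dualMap x))
    (hadd₂ : ∀ Λ ∈ 𝓛₂, ∀ Z ∈ 𝓛₀, ∀ Z' ∈ 𝓛₀, (fun x ↦ Λ x +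
      (Z ((degeneracyMap0 M₀ M₂ 1 2).dualMap x) + Z' ((degeneracyMap0 M₀ M₂ ℓ₁ 2).dualMap x))) ∈ 𝓛₂)
    (hinj : ∀ H ∈ 𝓛₂, ∀ H' ∈ 𝓛₂,
      (∀ y ∈ periodHomology N,
        H ((degeneracyMap0 M₂ N 1 2).dualMap y) + H' ((degeneracyMap0 M₂ N ℓ₂ 2).dualMap y) = 0) →
      (∀ x ∈ periodHomology M₂, H x = 0) ∧ (∀ x ∈ periodHomology M₂, H' x = 0)) :
    ∀ Λ₁ ∈ 𝓛₁, ∀ Λ₁' ∈ 𝓛₁, ∀ Λ₂ ∈ 𝓛₂, ∀ Λ₂' ∈ 𝓛₂,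
      (∀ y ∈ periodHomology N,
        Λ₁ ((degeneracyMap0 M₁ N 1 2).dualMap y) + Λ₁' ((degeneracyMap0 M₁ N ℓ₁ 2).dualMap y) +
        (Λ₂ ((degeneracyMap0 M₂ N 1 2).dualMap y) + Λ₂' ((degeneracyMap0 M₂ N ℓ₂ 2).dualMap y)) = 0) →
      ∃ Z₁ ∈ 𝓛₀, ∃ Z₂ ∈ 𝓛₀, ∃ Z₃ ∈ 𝓛₀, ∃ Z₄ ∈ 𝓛₀,
        (∀ x ∈ periodHomology M₁, Λ₁ x =
          Z₁ ((degeneracyMap0 M₀ M₁ 1 2).dualMap x) + Z₂ ((degeneracyMap0 M₀ M₁ ℓ₂ 2).dualMap x)) ∧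
        (∀ x ∈ periodHomology M₁, Λ₁' x =
          Z₃ ((degeneracyMap0 M₀ M₁ 1 2).dualMap x) + Z₄ ((degeneracyMap0 M₀ M₁ ℓ₂ 2).dualMap x)) ∧
        (∀ x ∈ periodHomology M₂, Λ₂ x =
          -(Z₁ ((degeneracyMap0 M₀ M₂ 1 2).dualMap x) + Z₃ ((degeneracyMap0 M₀ M₂ ℓ₁ 2).dualMap x))) ∧
        (∀ x ∈ periodHomology M₂, Λ₂' x =
          -(Z₂ ((degeneracyMap0 M₀ M₂ 1 2).dualMap x) + Z₄ ((degeneracyMap0 M₀ M₂ ℓ₁ 2).dualMap x))) := by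
  intro Λ₁ hΛ₁ Λ₁' hΛ₁' Λ₂ hΛ₂ Λ₂' hΛ₂' hrel
  obtain ⟨Z₁, hZ₁, Z₂, hZ₂, e1⟩ := hold₁ Λ₁ hΛ₁
  obtain ⟨Z₃, hZ₃, Z₄, hZ₄, e1'⟩ := hold₁ Λ₁' hΛ₁'
  have hm1 : ∀ y ∈ periodHomology N, (degeneracyMap0 M₁ N 1 2).dualMap y ∈ periodHomology M₁ :=
    fun y hy ↦ dualMap_degeneracyMap0_mem_periodHomology M₁ N 1 h1N hy
  have hm1' : ∀ y ∈ periodHomology N, (degeneracyMap0 M₁ N ℓ₁ 2).dualMap y ∈ periodHomology M₁ :=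
    fun y hy ↦ dualMap_degeneracyMap0_mem_periodHomology M₁ N ℓ₁ h1N' hy
  -- the four factorizations `M₀ → M₁ → N` = `M₀ → M₂ → N`
  have c11 : ∀ y, (degeneracyMap0 M₀ M₁ 1 2).dualMap ((degeneracyMap0 M₁ N 1 2).dualMap y) =
      (degeneracyMap0 M₀ M₂ 1 2).dualMap ((degeneracyMap0 M₂ N 1 2).dualMap y) := fun y ↦ by
    rw [dualMap_dualMap_degeneracyMap0 h01 h1N, dualMap_dualMap_degeneracyMap0 h02 h2N]
  have c12 : ∀ y, (degeneracyMap0 M₀ M₁ ℓ₂ 2).dualMap ((degeneracyMap0 M₁ N 1 2).dualMap y) =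
      (degeneracyMap0 M₀ M₂ 1 2).dualMap ((degeneracyMap0 M₂ N ℓ₂ 2).dualMap y) := fun y ↦ by
    rw [dualMap_dualMap_degeneracyMap0 h01' h1N, dualMap_dualMap_degeneracyMap0 h02 h2N']
    exact dualMap_degeneracyMap0_congr (by rw [mul_one, one_mul]) y
  have c21 : ∀ y, (degeneracyMap0 M₀ M₁ 1 2).dualMap ((degeneracyMap0 M₁ N ℓ₁ 2).dualMap y) =
      (degeneracyMap0 M₀ M₂ ℓ₁ 2).dualMap ((degeneracyMap0 M₂ N 1 2).dualMap y) := fun y ↦ by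
    rw [dualMap_dualMap_degeneracyMap0 h01 h1N', dualMap_dualMap_degeneracyMap0 h02' h2N]
    exact dualMap_degeneracyMap0_congr (by rw [mul_one, one_mul]) y
  have c22 : ∀ y, (degeneracyMap0 M₀ M₁ ℓ₂ 2).dualMap ((degeneracyMap0 M₁ N ℓ₁ 2).dualMap y) =
      (degeneracyMap0 M₀ M₂ ℓ₁ 2).dualMap ((degeneracyMap0 M₂ N ℓ₂ 2).dualMap y) := fun y ↦ by
    rw [dualMap_dualMap_degeneracyMap0 h01' h1N', dualMap_dualMap_degeneracyMap0 h02' h2N']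
    exact dualMap_degeneracyMap0_congr (Nat.mul_comm _ _) y
  -- `H := Λ₂ + Z₁∘d₁ + Z₃∘d_{ℓ₁}`, `H' := Λ₂' + Z₂∘d₁ + Z₄∘d_{ℓ₁}` satisfy `H∘d²₁ + H'∘d²_{ℓ₂} = 0`
  obtain ⟨hH, hH'⟩ := hinj _ (hadd₂ Λ₂ hΛ₂ Z₁ hZ₁ Z₃ hZ₃) _ (hadd₂ Λ₂' hΛ₂' Z₂ hZ₂ Z₄ hZ₄)
    (fun y hy ↦ by
      have h0 := hrel y hy
      have h1 := e1 _ (hm1 y hy)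
      have h2 := e1' _ (hm1' y hy)
      rw [c11, c12] at h1
      rw [c21, c22] at h2
      rw [h1, h2] at h0
      linear_combination h0)
  refine ⟨Z₁, hZ₁, Z₂, hZ₂, Z₃, hZ₃, Z₄, hZ₄, e1, e1', fun x hx ↦ ?_, fun x hx ↦ ?_⟩
  · have := hH x hx; linear_combination this
  · have := hH' x hx; linear_combination this

end SubpartitionCycles

end Summit.BirchSwinnertonDyer.Rank1Residual.LevelLowering

end
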